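import Mathlib.LinearAlgebra.BilinearForm.Orthogonal
import Mathlib.LinearAlgebra.FiniteDimensional.Lemmas
import HarnessLib

/-!
# `WeilSixfoldsSqrtMinus7` (stmt-HodgeConjecture-1260) · line `semiregular-clean-lci-six` · the isotropy bound
# that kills the sub-torus design (H1) of `stub_semiregularCleanLciSix`

Support lemma (kernel-checked core of a hand argument recorded in the crux directory, lead c12, 2026-08-17) for
the crux `HeckePrymWeil.WeilSixfoldsSqrtMinus7`, line `Cruxes/WeilSixfoldsSqrtMinus7/Lines/semiregular_clean_lci_six.lean`.

The line's hardest stub asks for a CLEAN, CHARGED, Bloch-semiregular local complete intersection 3-fold `Z` on the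
CM/tensor anchor sixfold `Y₀ = E³ × E³`; its card's first design ("H1", STRATEGY-CENSUS §3/§6, card §Hardest stub)
is a disjoint union `Z = ⊔ᵢ (Zᵢ + tᵢ)` of `T ≤ 25` translated abelian sub-3-folds. The dictionary (by hand, NOTES.md
of the lead): with `V = Lie Y₀ ≅ ℂ⁶` and `ψᵢ ∈ ∧³V` the Plücker vector of `Vᵢ = Lie Zᵢ`,
* the 400 Hodge numbers `∫_Z α_I ∧ ᾱ_J` of `[Z]` form the Hermitian matrix `H_Z = Σᵢ cᵢ ψᵢψᵢ^†` (`cᵢ > 0`), and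
  `[Z]` clean & charged forces `H_Z = diag(6β·w_{Iᶜ}) + μE_{AB} + μ̄E_{BA}`, of rank `≥ 19` (all twenty diagonal
  entries are positive), so the `ψᵢ` must span a subspace of dimension `≥ 19` of the `20`-dimensional `∧³V`;
* two translated sub-tori can be made disjoint iff `Vᵢ + Vⱼ ≠ V` iff `Vᵢ ∩ Vⱼ ≠ 0` iff `ψᵢ ∧ ψⱼ = 0` in `∧⁶V ≅ ℂ`,
  and `(x, y) ↦ x ∧ y` is a NON-DEGENERATE ALTERNATING bilinear form on `∧³V` (`3·3` odd).
Hence the `ψᵢ` of a pairwise-disjoint design are pairwise orthogonal for a non-degenerate alternating form, so they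
span a totally isotropic subspace, of dimension `≤ 20/2 = 10 < 19`: NO disjoint union of translated abelian
sub-3-folds of an abelian 6-fold has a clean class (any polarisation weights, any `T`, split or not) — design H1 is
empty. (Unions meeting pairwise along surfaces, the only other lci configurations of sub-tori, have all `Vᵢ` through a
common plane or inside a common 4-space, so `dim span ψᵢ ≤ 4`.) The same bound (`dim ≤ ½·C(2n,n)`, the pairing
`∧ⁿ × ∧ⁿ → ∧²ⁿ` being `(-1)ⁿ`-symmetric and perfect) empties the analogous sub-torus designs of the sibling line
`semiregular-clean-lci-anchor` of crux 1261 at `(7,6)`.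

What is HERE (sorry-free, Mathlib only): the linear-algebra core, for any field and any non-degenerate bilinear form —
`two_mul_finrank_le_of_le_orthogonal` (a totally isotropic subspace has at most half the dimension) and
`two_mul_finrank_span_le_of_pairwise_orthogonal` (a pairwise-orthogonal, self-orthogonal family spans at most half the
dimension), with the numerical instance `finrank_span_le_ten_of_pairwise_orthogonal` (`finrank V = 20 ⇒ ≤ 10`).
What is NOT here: the dictionary `[Z] ↦ H_Z`, Plücker coordinates, the wedge pairing on `∧³V` (the tree has no
cycle class of a sub-torus in `complexBetti`); those steps are the hand argument above.
-/

-- `Summit.<Summit>.<Problem>` repeats `HodgeConjecture` by the tree's layout (lakefile sets the same option weakly).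
set_option linter.dupNamespace false

namespace Summit.HodgeConjecture.HodgeConjecture.Theorems.WeilSixfoldsSqrtMinus7.SubtorusDesign

open Module LinearMap

variable {K V : Type*} [Field K] [AddCommGroup V] [Module K V] [FiniteDimensional K V]

/-- **A totally isotropic subspace of a non-degenerate bilinear form has at most half the dimension**:
if `W ≤ W^⊥` for a non-degenerate bilinear form `B` on the finite-dimensional `V`, then
`2 · dim W ≤ dim V` (since `dim W^⊥ = dim V - dim W`). [folklore] -/
theorem two_mul_finrank_le_of_le_orthogonal {B : LinearMap.BilinForm K V} (hB : B.Nondegenerate)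
    {W : Submodule K V} (hW : W ≤ B.orthogonal W) : 2 * finrank K W ≤ finrank K V := by
  have h1 : finrank K W ≤ finrank K (B.orthogonal W) := Submodule.finrank_mono hW
  have h2 : finrank K (B.orthogonal W) = finrank K V - finrank K W := B.finrank_orthogonal hB W
  have h3 : finrank K W ≤ finrank K V := Submodule.finrank_le W
  omega

/-- **A pairwise-orthogonal family of vectors (including each vector with itself — automatic for an alternating
form) spans a totally isotropic subspace, hence one of at most half the dimension.**  Applied in the module
docstring with `V = ∧³ℂ⁶` (`finrank 20`), `B = (x, y) ↦ x ∧ y` and `v i = ψᵢ` the Plücker vectors of the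
components of a pairwise-disjoint union of translated abelian sub-3-folds of an abelian 6-fold. [folklore] -/
theorem two_mul_finrank_span_le_of_pairwise_orthogonal {B : LinearMap.BilinForm K V} (hB : B.Nondegenerate)
    {ι : Type*} (v : ι → V) (h : ∀ i j, B (v i) (v j) = 0) :
    2 * finrank K (Submodule.span K (Set.range v)) ≤ finrank K V := by
  refine two_mul_finrank_le_of_le_orthogonal hB ?_
  rw [Submodule.span_le]
  rintro _ ⟨i, rfl⟩
  rw [SetLike.mem_coe, LinearMap.BilinForm.mem_orthogonal_iff]
  intro y hy
  refine Submodule.span_induction (p := fun y _ => B y (v i) = 0) ?_ ?_ ?_ ?_ hy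
  · rintro _ ⟨j, rfl⟩
    exact h j i
  · rw [map_zero, LinearMap.zero_apply]
  · intro x y _ _ hx hy
    rw [map_add, LinearMap.add_apply, hx, hy, add_zero]
  · intro a x _ hx
    rw [map_smul, LinearMap.smul_apply, hx, smul_zero]

/-- **The numerical instance used against design H1**: in dimension `20` (`= dim ∧³ℂ⁶`) a pairwise-orthogonal
family for a non-degenerate bilinear form spans a subspace of dimension `≤ 10` — in particular it cannot span a
subspace of dimension `≥ 19`, which a clean charged class would require. [folklore] -/
theorem finrank_span_le_ten_of_pairwise_orthogonal {B : LinearMap.BilinForm K V} (hB : B.Nondegenerate)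
    (hV : finrank K V = 20) {ι : Type*} (v : ι → V) (h : ∀ i j, B (v i) (v j) = 0) :
    finrank K (Submodule.span K (Set.range v)) ≤ 10 := by
  have := two_mul_finrank_span_le_of_pairwise_orthogonal hB v h
  omega

/-- **Registered form (sub-goal `subtorusDesign_isotropyBound` of stmt-HodgeConjecture-1260)** of the isotropy bound,
with explicit binders: for a non-degenerate bilinear form on a `20`-dimensional space over any field, a family of
vectors that is pairwise orthogonal (each vector with itself included) spans a subspace of dimension `≤ 10`.  Read with
`V = ∧³ℂ⁶`, `B = ∧`-pairing and `v` = the Plücker vectors of a pairwise-disjoint union of translated abelian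
sub-3-folds of an abelian 6-fold, it says their classes span `≤ 10 < 19` of the Plücker directions a clean charged
class needs — design H1 of `stub_semiregularCleanLciSix` is empty (module docstring). [folklore] -/
theorem subtorusDesign_isotropyBound :
    ∀ (K V : Type) [Field K] [AddCommGroup V] [Module K V] [FiniteDimensional K V]
      (B : LinearMap.BilinForm K V), B.Nondegenerate → Module.finrank K V = 20 →
      ∀ (ι : Type) (v : ι → V), (∀ i j : ι, B (v i) (v j) = 0) →
        Module.finrank K (Submodule.span K (Set.range v)) ≤ 10 :=
  fun _ _ _ _ _ _ _ hB hV _ v h => finrank_span_le_ten_of_pairwise_orthogonal hB hV v h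

end Summit.HodgeConjecture.HodgeConjecture.Theorems.WeilSixfoldsSqrtMinus7.SubtorusDesign
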